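/-
Copyright (c) 2026 the pub-hodgecm-mathlib formalisation cell (harness21).  Prover seat hodgecm-mathlib-K2E5-p17 (g7), Track B «K2-LIT» ∕ h413
(`stmt-HodgeConjecture-24833`), line `K2_E3_EllipticInputs`, leaf (nsc-S-A′), brick GEO-QB (dealer D92; architect K2E3-p25 (g2) MEMO-SA-architecture v2 §3;
hand-off plan K2E3-p21 (g6) `MEMO-GEOQB-handoff.v1`), part (G3b).  2026-09-04.
-/
import Summits.HodgeConjecture.HodgeConjecture.Theorems.K2E3GL3StandardModuleJacquetCells   -- ★ GEO-QB (G3a) (this seat): `(Q,B)`-cell data, the line of the cell `1`; brings (G2), E3β₁∕E3β₂∕E3β₃a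
import HarnessLib

/-!
# K2_E3 road (h413), leaf (nsc-S-A′), brick GEO-QB (G3b) — the `(Q, B)`-cells `s₂` and `s₁s₂` of `Ind_Q^{GL₃} σ′` contribute exactly a line each to the Borel Jacquet module,
# with exponents `χ ∘ Ad(P_{s₂})`, `χ ∘ Ad(P_{s₁s₂})`

Cell `pub/hodgecm-mathlib` (D-0151), Track B, seat K2E5-p17 (g7); plan K2E3-p21 (g6) `K2/K2E3-p21/g6/MEMO-GEOQB-handoff.v1.K2E3-p21-g6.md` §2–§3.  `--supports stmt-HodgeConjecture-24833 --as helper`;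
THEOREMS ONLY (no definition ∕ instance ∕ notation ∕ `sorry`); never imports `Cruxes/…/Lines`; COUNT-NEUTRAL.  Currency as in ★ (G3a): `Q = P₂₁ = standardParabolicGL F ![f,f,t]`, `U = U₃`,
`B = P_{id}`, `T` the diagonal torus, `U_{Q′} = unipotentRadicalGL F ![f,t,t]` (roots (0,1),(0,2)), `U_{α₂} = U_Q ⊓ M_{Q′}` (root (1,2)); `σ′` is ANY smooth representation of `Q` on `ℂ` whose
restriction to `B ≤ Q` is the Borel inducing character `δ_B^{1∕2} · (χ ∘ proj_B)` of a character `χ` of `T` (hypothesis `hσB`; for the standard module `D(η,ψ)` this is ★ (G3a)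
`inducingCharQ_apply_borel` with `χ = tch θ_D`, `θ_D = (ην½⁻¹, ην½, ψ)`).

THE MATHEMATICS ([BernsteinZelevinsky1977, Thm. 5.2 — geometric lemma for `(Q,B)`]; [Casselman1995, §6.3, Thm. 6.3.5]).  For the cells `w = s₂` (datum `(S,Γ) = (U_{Q′}, U_{α₂})`) and
`w = s₁s₂` (datum `(U_{α₂}, U_{Q′})`) of `Q\GL₃/B`, the Haar functional `f ↦ ∫_Γ f(P_w γ) dγ` on `X^< = {f ∈ Ind_Q σ′ : f|_{cellLT ![f,f,t] w} = 0}` is `U`-invariant and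
`T`-equivariant with character `(χ ∘ proj_B ∘ Ad(P_w) ∘ diag) · δ_B^{1∕2} ∘ diag` — the proofs are ★ E3β₃a §3 ∕ ★ E3β₃b §2 TOKEN FOR TOKEN, the only changes being (i) the general
`(P_c,B)`-cell theorem ★ GEO-QB (G2) `K2E3ParabolicCellJacquetLine.exists_lineFunctional_of_cellDatum` in place of ★ E3γ2, (ii) the `(Q,B)`-cell data of ★ (G3a) §3, (iii) `σ′(b) =
δ_B^{1∕2}(b) χ(proj_B b)` on `B` (`hσB`) in place of ★ `inducingChar_apply`.  Output per cell: a functional `Λ_w` on `J = r_U(Ind_Q σ′)` with `ker Λ_w ∩ F^<_w = F^≤_w`, `Λ_w ≠ 0` on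
`F^<_w`, and `Λ_w(r(m)x) = χ(proj_B(P_w diag(m) P_w⁻¹))·Λ_w(x)` for the NORMALISED torus action `r = normalizedJacquetGL F id (Ind_Q σ′)`.
HONEST LABEL: HC_CM is proved only modulo the 7 printed citations (2 remaining named inputs: hLiu418 = stmt-HodgeConjecture-24832, h413 = stmt-HodgeConjecture-24833) until rung 0
closes; count-neutral helper (no printed citation is discharged).

## Mathlib ∕ tree search
Tree ★: (G2) `exists_lineFunctional_of_cellDatum` · (G3a) `cellDatumQ_swap_one_two`∕`cellDatumQ_cycle_one_two_zero` · E3β₁ `cellDatum_swap_one_two`∕`cellDatum_cycle_one_two_zero` (the `B`-clause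
`P_w S P_w⁻¹ ⊆ B`, used for `hinv`)∕`mem_rootGroup_oneTwo_iff`∕`eq_coord`∕`permGL_conj_apply`∕`rootSubgroups_le` · E3β₂ `exists_proj_*`∕`exists_homeomorph_rootGroup_oneTwo`∕
`exists_homeomorph_unipotentRadicalGL_oneTwo`∕`measure_map_addHomeomorph`∕`map_prodScale`∕`blockDiagonalGL_inv_mul_coord_mul`∕`rootGroup_oneTwo_inv_mul_coord_mul` · E3β₃a
`inducingChar_apply(_of_mem_upperUnitriangular)`∕`conj_mem_unipotentRadicalGL_of_mem_parabolic`∕`upperUnitriangular_le_parabolic_two_block` · `rootDeltaChar_borel_three`.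
Mathlib: `MeasureTheory.integral_mul_right_eq_self`, `MeasurePreserving.skew_product`, `Measure.map_add_right_eq_self`, `Homeomorph.mulLeft₀`.  Dedup: `rg "cellQ_swap_one_two|cellQ_cycle"` — none.

## References
* [BernsteinZelevinsky1977] I. N. Bernstein, A. V. Zelevinsky, *Induced representations of reductive p-adic groups I*, Ann. Sci. ÉNS 10 (1977), 1.7–1.9, §2.3, Thm. 5.2.
* [Casselman1995] W. Casselman, *Introduction to the theory of admissible representations of p-adic reductive groups* (draft 1995), §1.5, §6.3 (Prop. 6.3.3, Thm. 6.3.5).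
-/

set_option autoImplicit false
-- the mandated namespace repeats `HodgeConjecture.HodgeConjecture`, as in every `Theorems/*.lean` of this sub-problem
set_option linter.dupNamespace false

noncomputable section

open Set Function MeasureTheory Measure Filter Representation
open scoped MatrixGroups NNReal ENNReal

namespace Summit.HodgeConjecture.HodgeConjecture.Cruxes.H413.K2E3GL3StandardModuleJacquetLines

open Literature.NumberTheory.Automorphic ValuativeRel
open Literature.NumberTheory.GaloisRepresentations Literature.NumberTheory.GaloisRepresentations.IsNonarchimedeanLocalField
open Summit.HodgeConjecture.HodgeConjecture.Cruxes.H413.K2E3GL3BorelUnipotentHaar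
open Summit.HodgeConjecture.HodgeConjecture.Cruxes.H413.K2E3GL3BruhatCellSubgroups
open Summit.HodgeConjecture.HodgeConjecture.Cruxes.H413.K2E3GL3BruhatCellHaar
open Summit.HodgeConjecture.HodgeConjecture.Cruxes.H413.K2E3BorelCellJacquetLine (permGL_conj_blockDiagonalGL_mem_borel)
open Summit.HodgeConjecture.HodgeConjecture.Cruxes.H413.K2E3BorelCellCoinvariantsBound (permGL_conj_mem_upperUnitriangular)
open Summit.HodgeConjecture.HodgeConjecture.Cruxes.H413.K2E3GL3BruhatCellFunctionals
open Summit.HodgeConjecture.HodgeConjecture.Cruxes.H413.K2E3GL3InductionInStagesEmbedding (monotone_twoOne)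
open Summit.HodgeConjecture.HodgeConjecture.Cruxes.H413.K2E3GL3StandardModuleJacquetCells

variable {F : Type} [Field F] [ValuativeRel F] [TopologicalSpace F] [IsNonarchimedeanLocalField F]
  (σ' : Representation ℂ ↥(standardParabolicGL F (![false, false, true] : Fin 3 → Bool)) ℂ) (χ : (Π a : Fin 3, GL {i : Fin 3 // (id : Fin 3 → Fin 3) i = a} F) →* ℂˣ)

/-! ## §1 Cell `s₂ = (1 2)`: `Γ = U_{α₂} ≅ F`, `S = U_{Q′}` -/

set_option maxHeartbeats 400000 in
/-- **The `(Q,B)`-cell `s₂ = (1 2)` contributes exactly a line to `r_U(Ind_Q σ′)`, with exponent `χ ∘ Ad(P_{s₂})`** — for every smooth character `σ′` of `Q` on `ℂ` whose restriction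
to `B` is `δ_B^{1∕2}·(χ ∘ proj_B)` (`hσB`).  ★ GEO-QB (G2) with the `(Q,B)`-cell datum `(U_{Q′}, U_{α₂})` of ★ (G3a) §3, the Haar measure of ★ E3β₂ transported from `μ_F`; `hinv` by normality
of `U_{Q′}` in `Q′ ⊇ U` and right invariance; `hT` by the substitution `y ↦ (d₂/d₁)y` of module `‖d₁/d₂‖ = δ_B^{1/2}(diag)/δ_B^{1/2}(P diag P⁻¹)` (★ E3β₃a verbatim with `P_{id} ↦ Q`).
[cite: BernsteinZelevinsky1977, Thm. 5.2] [cite: Casselman1995, §6.3, Thm. 6.3.5] -/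
theorem exists_lineFunctional_cellQ_swap_one_two (hσ' : σ'.IsSmooth)
    (hσB : ∀ (g : GL (Fin 3) F) (hg : g ∈ standardParabolicGL F (id : Fin 3 → Fin 3)) (z : ℂ),
      σ' ⟨g, borel_le_standardParabolicGL monotone_twoOne hg⟩ z =
        ((rootDeltaChar (standardParabolicGL F (id : Fin 3 → Fin 3)) ⟨g, hg⟩ : ℂˣ) : ℂ) * ((((χ (leviProjection F (id : Fin 3 → Fin 3) ⟨g, hg⟩)) : ℂˣ) : ℂ) * z)) :
    let I := smoothIndRep (standardParabolicGL F (![false, false, true] : Fin 3 → Bool)) σ'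
    let mk := Coinvariants.mk (restrictUnipotentGL F (id : Fin 3 → Fin 3) I)
    let Flt := (vanishingOn (standardParabolicGL F (![false, false, true] : Fin 3 → Bool)) σ' (cellLT (K := F) (![false, false, true] : Fin 3 → Bool) (Equiv.swap (1 : Fin 3) 2))).map mk
    let Fle := (vanishingOn (standardParabolicGL F (![false, false, true] : Fin 3 → Bool)) σ' (cellLE (K := F) (![false, false, true] : Fin 3 → Bool) (Equiv.swap (1 : Fin 3) 2))).map mk
    ∃ Λ : (restrictUnipotentGL F (id : Fin 3 → Fin 3) I).Coinvariants →ₗ[ℂ] ℂ,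
      (∀ x ∈ Flt, Λ x = 0 ↔ x ∈ Fle) ∧ (∃ x ∈ Flt, Λ x ≠ 0) ∧
      ∀ (m : (Π a : Fin 3, GL {i : Fin 3 // (id : Fin 3 → Fin 3) i = a} F)), ∀ x ∈ Flt,
        Λ (Representation.normalizedJacquetGL F (id : Fin 3 → Fin 3) I m x) =
          ((χ (leviProjection F (id : Fin 3 → Fin 3) ⟨(permGL (Equiv.swap (1 : Fin 3) 2) : GL (Fin 3) F) * blockDiagonalGL F (id : Fin 3 → Fin 3) m * (permGL (Equiv.swap (1 : Fin 3) 2) : GL (Fin 3) F)⁻¹, permGL_conj_blockDiagonalGL_mem_borel (Equiv.swap (1 : Fin 3) 2) m⟩) : ℂˣ) : ℂ) * Λ x := by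
  intro I mk Flt Fle
  -- `σ′` is trivial on `U` (`U ≤ B`, ★ E3β₃a)
  have hσU : ∀ (u : GL (Fin 3) F) (hu : u ∈ upperUnitriangular (Fin 3) F) (z : ℂ),
      σ' ⟨u, borel_le_standardParabolicGL monotone_twoOne (unipotentRadicalGL_le F (id : Fin 3 → Fin 3) hu)⟩ z = z := fun u hu z => by
    rw [hσB _ (unipotentRadicalGL_le F (id : Fin 3 → Fin 3) hu), ← inducingChar_apply]
    exact inducingChar_apply_of_mem_upperUnitriangular χ hu z
  haveI : T2Space F := (isLocalField F).toT2Space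
  haveI : LocallyCompactSpace F := (isLocalField F).toLocallyCompactSpace
  haveI : SecondCountableTopology F := secondCountableTopology_localField F
  letI : MeasurableSpace F := borel F
  haveI : BorelSpace F := ⟨rfl⟩
  -- the cell datum (★ E3β₁) and the retraction (★ E3β₂)
  obtain ⟨-, -, hSBB, -⟩ := cellDatum_swap_one_two (F := F)
  obtain ⟨hΓlow, hS, hSB, hdec⟩ := cellDatumQ_swap_one_two (F := F)
  have hΓU : (unipotentRadicalGL F (![false, false, true] : Fin 3 → Bool) ⊓ standardLeviGL F (![false, true, true] : Fin 3 → Bool)) ≤ upperUnitriangular (Fin 3) F := (rootSubgroups_le (F := F)).2.2.2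
  have hQU : unipotentRadicalGL F (![false, true, true] : Fin 3 → Bool) ≤ upperUnitriangular (Fin 3) F := (rootSubgroups_le (F := F)).2.1
  have hΓcl : IsClosed (((unipotentRadicalGL F (![false, false, true] : Fin 3 → Bool) ⊓ standardLeviGL F (![false, true, true] : Fin 3 → Bool)) : Subgroup (GL (Fin 3) F)) : Set (GL (Fin 3) F)) := by
    rw [Subgroup.coe_inf]; exact (isClosed_unipotentRadicalGL _).inter (isClosed_standardLeviGL _)
  have hΓlim : IsLimitOfCompactOpen ↥(unipotentRadicalGL F (![false, false, true] : Fin 3 → Bool) ⊓ standardLeviGL F (![false, true, true] : Fin 3 → Bool)) := (isLimitOfCompactOpen_upperUnitriangular F 3).of_le hΓU hΓcl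
  obtain ⟨proj, hproj, hprojS⟩ := exists_proj_swap_one_two (F := F)
  -- coordinates (★ p11) and the transported Haar measure on `Γ` (★ E3β₂)
  obtain ⟨e, he⟩ := exists_coordHomeomorph (R := F)
  obtain ⟨φ, hφ, hφadd⟩ := exists_homeomorph_rootGroup_oneTwo e he
  letI : MeasurableSpace ↥(unipotentRadicalGL F (![false, false, true] : Fin 3 → Bool) ⊓ standardLeviGL F (![false, true, true] : Fin 3 → Bool)) := borel _
  haveI : BorelSpace ↥(unipotentRadicalGL F (![false, false, true] : Fin 3 → Bool) ⊓ standardLeviGL F (![false, true, true] : Fin 3 → Bool)) := ⟨rfl⟩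
  obtain ⟨i1, i2, i3⟩ := measure_map_addHomeomorph φ hφadd (Measure.addHaar : Measure F)
  haveI := i1; haveI := i2; haveI := i3
  have hme : MeasurableEmbedding φ := φ.measurableEmbedding
  -- the torus character `e_w = (χ ∘ levi ∘ Ad P_w ∘ diag) · (δ^{1/2} ∘ diag)`
  let conjB : (Π a : Fin 3, GL {i : Fin 3 // (id : Fin 3 → Fin 3) i = a} F) →* ↥(standardParabolicGL F (id : Fin 3 → Fin 3)) :=
    ((MulAut.conj (permGL (Equiv.swap (1 : Fin 3) 2) : GL (Fin 3) F)).toMonoidHom.comp (blockDiagonalGL F (id : Fin 3 → Fin 3))).codRestrict (standardParabolicGL F (id : Fin 3 → Fin 3))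
      (fun m => permGL_conj_blockDiagonalGL_mem_borel (Equiv.swap (1 : Fin 3) 2) m)
  have hconjB : ∀ m : (Π a : Fin 3, GL {i : Fin 3 // (id : Fin 3 → Fin 3) i = a} F), ((conjB m : ↥(standardParabolicGL F (id : Fin 3 → Fin 3))) : GL (Fin 3) F) = (permGL (Equiv.swap (1 : Fin 3) 2) : GL (Fin 3) F) * blockDiagonalGL F (id : Fin 3 → Fin 3) m * (permGL (Equiv.swap (1 : Fin 3) 2) : GL (Fin 3) F)⁻¹ := fun m => rfl
  let ew : (Π a : Fin 3, GL {i : Fin 3 // (id : Fin 3 → Fin 3) i = a} F) →* ℂˣ := (χ.comp ((leviProjection F (id : Fin 3 → Fin 3)).comp conjB)) *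
    (rootDeltaChar (standardParabolicGL F (id : Fin 3 → Fin 3))).comp (leviEmbeddingP F (id : Fin 3 → Fin 3))
  obtain ⟨Λ, hker, hne, hequiv⟩ := K2E3ParabolicCellJacquetLine.exists_lineFunctional_of_cellDatum (![false, false, true] : Fin 3 → Bool) monotone_twoOne σ' (Equiv.swap (1 : Fin 3) 2) (unipotentRadicalGL F (![false, false, true] : Fin 3 → Bool) ⊓ standardLeviGL F (![false, true, true] : Fin 3 → Bool)) (unipotentRadicalGL F (![false, true, true] : Fin 3 → Bool)) hσ'
    hΓU hΓcl hΓlim hΓlow hS hSB hdec proj hproj hprojS ((Measure.addHaar : Measure F).map φ)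
    (by
      intro u hu f hf
      obtain ⟨s₀, hs₀, γ₀, hγ₀, rfl⟩ := hdec u hu
      have hfun : (fun γ : ↥(unipotentRadicalGL F (![false, false, true] : Fin 3 → Bool) ⊓ standardLeviGL F (![false, true, true] : Fin 3 → Bool)) => (smoothIndRep (standardParabolicGL F (![false, false, true] : Fin 3 → Bool)) σ' (s₀ * γ₀) f).toFun ((permGL (Equiv.swap (1 : Fin 3) 2) : GL (Fin 3) F) * ((γ : ↥(unipotentRadicalGL F (![false, false, true] : Fin 3 → Bool) ⊓ standardLeviGL F (![false, true, true] : Fin 3 → Bool))) : GL (Fin 3) F))) =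
          fun γ => f.toFun ((permGL (Equiv.swap (1 : Fin 3) 2) : GL (Fin 3) F) * (((γ * ⟨γ₀, hγ₀⟩ : ↥(unipotentRadicalGL F (![false, false, true] : Fin 3 → Bool) ⊓ standardLeviGL F (![false, true, true] : Fin 3 → Bool)))) : GL (Fin 3) F)) := by
        funext γ
        have hγU : ((γ : ↥(unipotentRadicalGL F (![false, false, true] : Fin 3 → Bool) ⊓ standardLeviGL F (![false, true, true] : Fin 3 → Bool))) : GL (Fin 3) F) ∈ upperUnitriangular (Fin 3) F := hΓU γ.2
        have hγQ : ((γ : ↥(unipotentRadicalGL F (![false, false, true] : Fin 3 → Bool) ⊓ standardLeviGL F (![false, true, true] : Fin 3 → Bool))) : GL (Fin 3) F) ∈ standardParabolicGL F (![false, true, true] : Fin 3 → Bool) :=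
          (upperUnitriangular_le_parabolic_two_block (F := F)).2 hγU
        have hmemS : ((γ : ↥(unipotentRadicalGL F (![false, false, true] : Fin 3 → Bool) ⊓ standardLeviGL F (![false, true, true] : Fin 3 → Bool))) : GL (Fin 3) F) * s₀ * ((γ : ↥(unipotentRadicalGL F (![false, false, true] : Fin 3 → Bool) ⊓ standardLeviGL F (![false, true, true] : Fin 3 → Bool))) : GL (Fin 3) F)⁻¹ ∈ unipotentRadicalGL F (![false, true, true] : Fin 3 → Bool) := conj_mem_unipotentRadicalGL_of_mem_parabolic _ hγQ hs₀
        have hB' := hSBB _ hmemS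
        have hU' : (permGL (Equiv.swap (1 : Fin 3) 2) : GL (Fin 3) F) * (((γ : ↥(unipotentRadicalGL F (![false, false, true] : Fin 3 → Bool) ⊓ standardLeviGL F (![false, true, true] : Fin 3 → Bool))) : GL (Fin 3) F) * s₀ * ((γ : ↥(unipotentRadicalGL F (![false, false, true] : Fin 3 → Bool) ⊓ standardLeviGL F (![false, true, true] : Fin 3 → Bool))) : GL (Fin 3) F)⁻¹) * (permGL (Equiv.swap (1 : Fin 3) 2) : GL (Fin 3) F)⁻¹ ∈ upperUnitriangular (Fin 3) F := permGL_conj_mem_upperUnitriangular _ (hQU hmemS) hB'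
        rw [toFun_smoothIndRep_apply]
        have hprod : (permGL (Equiv.swap (1 : Fin 3) 2) : GL (Fin 3) F) * ((γ : ↥(unipotentRadicalGL F (![false, false, true] : Fin 3 → Bool) ⊓ standardLeviGL F (![false, true, true] : Fin 3 → Bool))) : GL (Fin 3) F) * (s₀ * γ₀) =
            ((permGL (Equiv.swap (1 : Fin 3) 2) : GL (Fin 3) F) * (((γ : ↥(unipotentRadicalGL F (![false, false, true] : Fin 3 → Bool) ⊓ standardLeviGL F (![false, true, true] : Fin 3 → Bool))) : GL (Fin 3) F) * s₀ * ((γ : ↥(unipotentRadicalGL F (![false, false, true] : Fin 3 → Bool) ⊓ standardLeviGL F (![false, true, true] : Fin 3 → Bool))) : GL (Fin 3) F)⁻¹) * (permGL (Equiv.swap (1 : Fin 3) 2) : GL (Fin 3) F)⁻¹) * ((permGL (Equiv.swap (1 : Fin 3) 2) : GL (Fin 3) F) * (((γ : ↥(unipotentRadicalGL F (![false, false, true] : Fin 3 → Bool) ⊓ standardLeviGL F (![false, true, true] : Fin 3 → Bool))) : GL (Fin 3) F) * γ₀)) := by group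
        rw [hprod, show (permGL (Equiv.swap (1 : Fin 3) 2) : GL (Fin 3) F) * (((γ : ↥(unipotentRadicalGL F (![false, false, true] : Fin 3 → Bool) ⊓ standardLeviGL F (![false, true, true] : Fin 3 → Bool))) : GL (Fin 3) F) * s₀ * ((γ : ↥(unipotentRadicalGL F (![false, false, true] : Fin 3 → Bool) ⊓ standardLeviGL F (![false, true, true] : Fin 3 → Bool))) : GL (Fin 3) F)⁻¹) * (permGL (Equiv.swap (1 : Fin 3) 2) : GL (Fin 3) F)⁻¹ =
            ((⟨_, borel_le_standardParabolicGL monotone_twoOne (unipotentRadicalGL_le F (id : Fin 3 → Fin 3) hU')⟩ : ↥(standardParabolicGL F (![false, false, true] : Fin 3 → Bool))) : GL (Fin 3) F) from rfl, SmoothInd.toFun_subgroup_mul,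
          hσU _ hU']
        rfl
      rw [hfun]
      exact integral_mul_right_eq_self (fun γ : ↥(unipotentRadicalGL F (![false, false, true] : Fin 3 → Bool) ⊓ standardLeviGL F (![false, true, true] : Fin 3 → Bool)) => f.toFun ((permGL (Equiv.swap (1 : Fin 3) 2) : GL (Fin 3) F) * ((γ : ↥(unipotentRadicalGL F (![false, false, true] : Fin 3 → Bool) ⊓ standardLeviGL F (![false, true, true] : Fin 3 → Bool))) : GL (Fin 3) F))) ⟨γ₀, hγ₀⟩
      ) ew (by
      intro m f hf
      have hd0 := blockDiagonalGL_id_three_apply_ne_zero m 0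
      have hd1 := blockDiagonalGL_id_three_apply_ne_zero m 1
      have hd2 := blockDiagonalGL_id_three_apply_ne_zero m 2
      have hmemB : (permGL (Equiv.swap (1 : Fin 3) 2) : GL (Fin 3) F) * blockDiagonalGL F (id : Fin 3 → Fin 3) m * (permGL (Equiv.swap (1 : Fin 3) 2) : GL (Fin 3) F)⁻¹ ∈ standardParabolicGL F (id : Fin 3 → Fin 3) := permGL_conj_blockDiagonalGL_mem_borel (Equiv.swap (1 : Fin 3) 2) m
      -- the integrand: `f(P γ t) = σ′(P t P⁻¹) · f(P (t⁻¹ γ t))`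
      have hfun : (fun γ : ↥(unipotentRadicalGL F (![false, false, true] : Fin 3 → Bool) ⊓ standardLeviGL F (![false, true, true] : Fin 3 → Bool)) => (smoothIndRep (standardParabolicGL F (![false, false, true] : Fin 3 → Bool)) σ' (blockDiagonalGL F (id : Fin 3 → Fin 3) m) f).toFun ((permGL (Equiv.swap (1 : Fin 3) 2) : GL (Fin 3) F) * ((γ : ↥(unipotentRadicalGL F (![false, false, true] : Fin 3 → Bool) ⊓ standardLeviGL F (![false, true, true] : Fin 3 → Bool))) : GL (Fin 3) F))) =
          fun γ => (((rootDeltaChar (standardParabolicGL F (id : Fin 3 → Fin 3)) ⟨_, hmemB⟩ : ℂˣ) : ℂ) * (((χ (leviProjection F (id : Fin 3 → Fin 3) ⟨_, hmemB⟩)) : ℂˣ) : ℂ)) *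
            f.toFun ((permGL (Equiv.swap (1 : Fin 3) 2) : GL (Fin 3) F) * ((blockDiagonalGL F (id : Fin 3 → Fin 3) m)⁻¹ * ((γ : ↥(unipotentRadicalGL F (![false, false, true] : Fin 3 → Bool) ⊓ standardLeviGL F (![false, true, true] : Fin 3 → Bool))) : GL (Fin 3) F) * blockDiagonalGL F (id : Fin 3 → Fin 3) m)) := by
        funext γ
        rw [toFun_smoothIndRep_apply]
        have hprod : (permGL (Equiv.swap (1 : Fin 3) 2) : GL (Fin 3) F) * ((γ : ↥(unipotentRadicalGL F (![false, false, true] : Fin 3 → Bool) ⊓ standardLeviGL F (![false, true, true] : Fin 3 → Bool))) : GL (Fin 3) F) * blockDiagonalGL F (id : Fin 3 → Fin 3) m = ((permGL (Equiv.swap (1 : Fin 3) 2) : GL (Fin 3) F) * blockDiagonalGL F (id : Fin 3 → Fin 3) m * (permGL (Equiv.swap (1 : Fin 3) 2) : GL (Fin 3) F)⁻¹) * ((permGL (Equiv.swap (1 : Fin 3) 2) : GL (Fin 3) F) * ((blockDiagonalGL F (id : Fin 3 → Fin 3) m)⁻¹ * ((γ : ↥(unipotentRadicalGL F (![false, false,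 true] : Fin 3 → Bool) ⊓ standardLeviGL F (![false, true, true] : Fin 3 → Bool))) : GL (Fin 3) F) * blockDiagonalGL F (id : Fin 3 → Fin 3) m)) := by group
        rw [hprod]
        refine (SmoothInd.toFun_subgroup_mul f ⟨_, borel_le_standardParabolicGL monotone_twoOne hmemB⟩ _).trans ?_
        rw [hσB _ hmemB]
        exact (mul_assoc _ _ _).symm
      rw [hfun, integral_const_mul]
      -- the substitution `γ ↦ t⁻¹ γ t` on `Γ ≅ F`: `x ↦ α x`, `α = d₁/d₀`, module `‖α⁻¹‖`
      have hα : (((blockDiagonalGL F (id : Fin 3 → Fin 3) m : GL (Fin 3) F) : Matrix (Fin 3) (Fin 3) F) 2 2 / ((blockDiagonalGL F (id : Fin 3 → Fin 3) m : GL (Fin 3) F) : Matrix (Fin 3) (Fin 3) F) 1 1) ≠ 0 := div_ne_zero hd2 hd1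
      have hconj : ∀ x : F, (blockDiagonalGL F (id : Fin 3 → Fin 3) m)⁻¹ * ((φ x : ↥(unipotentRadicalGL F (![false, false, true] : Fin 3 → Bool) ⊓ standardLeviGL F (![false, true, true] : Fin 3 → Bool))) : GL (Fin 3) F) * blockDiagonalGL F (id : Fin 3 → Fin 3) m =
          ((φ ((((blockDiagonalGL F (id : Fin 3 → Fin 3) m : GL (Fin 3) F) : Matrix (Fin 3) (Fin 3) F) 2 2 / ((blockDiagonalGL F (id : Fin 3 → Fin 3) m : GL (Fin 3) F) : Matrix (Fin 3) (Fin 3) F) 1 1) * x) : ↥(unipotentRadicalGL F (![false, false, true] : Fin 3 → Bool) ⊓ standardLeviGL F (![false, true, true] : Fin 3 → Bool))) : GL (Fin 3) F) := by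
        intro x
        rw [hφ, hφ, blockDiagonalGL_inv_mul_coord_mul e he m ((0, x), 0)]
        congr 2
        ext <;> simp; ring
      have hsub : ∫ γ, f.toFun ((permGL (Equiv.swap (1 : Fin 3) 2) : GL (Fin 3) F) * ((blockDiagonalGL F (id : Fin 3 → Fin 3) m)⁻¹ * ((γ : ↥(unipotentRadicalGL F (![false, false, true] : Fin 3 → Bool) ⊓ standardLeviGL F (![false, true, true] : Fin 3 → Bool))) : GL (Fin 3) F) * blockDiagonalGL F (id : Fin 3 → Fin 3) m)) ∂((Measure.addHaar : Measure F).map φ) =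
          ((normAbs F (((blockDiagonalGL F (id : Fin 3 → Fin 3) m : GL (Fin 3) F) : Matrix (Fin 3) (Fin 3) F) 2 2 / ((blockDiagonalGL F (id : Fin 3 → Fin 3) m : GL (Fin 3) F) : Matrix (Fin 3) (Fin 3) F) 1 1)⁻¹ : ℝ≥0) : ℝ) *
            ∫ γ, f.toFun ((permGL (Equiv.swap (1 : Fin 3) 2) : GL (Fin 3) F) * ((γ : ↥(unipotentRadicalGL F (![false, false, true] : Fin 3 → Bool) ⊓ standardLeviGL F (![false, true, true] : Fin 3 → Bool))) : GL (Fin 3) F)) ∂((Measure.addHaar : Measure F).map φ) := by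
        rw [hme.integral_map, hme.integral_map]
        simp_rw [hconj]
        have hmap := map_mul_left_addHaar (Measure.addHaar : Measure F) hα
        have heq := integral_map_equiv ((Homeomorph.mulLeft₀ _ hα).toMeasurableEquiv)
          (fun x : F => f.toFun ((permGL (Equiv.swap (1 : Fin 3) 2) : GL (Fin 3) F) * ((φ x : ↥(unipotentRadicalGL F (![false, false, true] : Fin 3 → Bool) ⊓ standardLeviGL F (![false, true, true] : Fin 3 → Bool))) : GL (Fin 3) F))) (μ := (Measure.addHaar : Measure F))
        rw [Homeomorph.toMeasurableEquiv_coe] at heq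
        change ∫ y, f.toFun ((permGL (Equiv.swap (1 : Fin 3) 2) : GL (Fin 3) F) * ((φ y : ↥(unipotentRadicalGL F (![false, false, true] : Fin 3 → Bool) ⊓ standardLeviGL F (![false, true, true] : Fin 3 → Bool))) : GL (Fin 3) F)) ∂((Measure.addHaar : Measure F).map (fun x => ((blockDiagonalGL F (id : Fin 3 → Fin 3) m : GL (Fin 3) F) : Matrix (Fin 3) (Fin 3) F) 2 2 / ((blockDiagonalGL F (id : Fin 3 → Fin 3) m : GL (Fin 3) F) : Matrix (Fin 3) (Fin 3) F) 1 1 * x)) =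
          ∫ x, f.toFun ((permGL (Equiv.swap (1 : Fin 3) 2) : GL (Fin 3) F) * ((φ (((blockDiagonalGL F (id : Fin 3 → Fin 3) m : GL (Fin 3) F) : Matrix (Fin 3) (Fin 3) F) 2 2 / ((blockDiagonalGL F (id : Fin 3 → Fin 3) m : GL (Fin 3) F) : Matrix (Fin 3) (Fin 3) F) 1 1 * x) : ↥(unipotentRadicalGL F (![false, false, true] : Fin 3 → Bool) ⊓ standardLeviGL F (![false, true, true] : Fin 3 → Bool))) : GL (Fin 3) F)) ∂(Measure.addHaar : Measure F) at heq
        rw [← heq, hmap, integral_smul_measure, ENNReal.coe_toReal, Complex.real_smul]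
      rw [hsub]
      -- the constant: `δ^{1/2}(P t P⁻¹) χ(…) ‖α⁻¹‖ = χ(…) δ^{1/2}(t) = e_w(m)`
      have hw0 : Equiv.swap (1 : Fin 3) 2 0 = 0 := by decide
      have hw2 : Equiv.swap (1 : Fin 3) 2 2 = 1 := by decide
      have hew : ((ew m : ℂˣ) : ℂ) = (((χ (leviProjection F (id : Fin 3 → Fin 3) ⟨_, hmemB⟩)) : ℂˣ) : ℂ) *
          ((rootDeltaChar (standardParabolicGL F (id : Fin 3 → Fin 3)) (leviEmbeddingP F (id : Fin 3 → Fin 3) m) : ℂˣ) : ℂ) := by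
        simp only [ew, MonoidHom.mul_apply, MonoidHom.coe_comp, Function.comp_apply, Units.val_mul]
        rfl
      have hδ1 : ((rootDeltaChar (standardParabolicGL F (id : Fin 3 → Fin 3)) ⟨_, hmemB⟩ : ℂˣ) : ℂ) =
          (((normAbs F (((blockDiagonalGL F (id : Fin 3 → Fin 3) m : GL (Fin 3) F) : Matrix (Fin 3) (Fin 3) F) 0 0) * (normAbs F (((blockDiagonalGL F (id : Fin 3 → Fin 3) m : GL (Fin 3) F) : Matrix (Fin 3) (Fin 3) F) 1 1))⁻¹ : ℝ≥0) : ℝ) : ℂ) := by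
        rw [K2E3GL3BorelModulus.rootDeltaChar_borel_three]
        simp only [permGL_conj_apply, hw0, hw2]
      have hδ2 : ((rootDeltaChar (standardParabolicGL F (id : Fin 3 → Fin 3)) (leviEmbeddingP F (id : Fin 3 → Fin 3) m) : ℂˣ) : ℂ) =
          (((normAbs F (((blockDiagonalGL F (id : Fin 3 → Fin 3) m : GL (Fin 3) F) : Matrix (Fin 3) (Fin 3) F) 0 0) * (normAbs F (((blockDiagonalGL F (id : Fin 3 → Fin 3) m : GL (Fin 3) F) : Matrix (Fin 3) (Fin 3) F) 2 2))⁻¹ : ℝ≥0) : ℝ) : ℂ) := by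
        rw [K2E3GL3BorelModulus.rootDeltaChar_borel_three, coe_leviEmbeddingP]
      have hn1 : normAbs F (((blockDiagonalGL F (id : Fin 3 → Fin 3) m : GL (Fin 3) F) : Matrix (Fin 3) (Fin 3) F) 1 1) ≠ 0 := (map_ne_zero _).2 hd1
      have hn2 : normAbs F (((blockDiagonalGL F (id : Fin 3 → Fin 3) m : GL (Fin 3) F) : Matrix (Fin 3) (Fin 3) F) 2 2) ≠ 0 := (map_ne_zero _).2 hd2
      have hn0 : normAbs F (((blockDiagonalGL F (id : Fin 3 → Fin 3) m : GL (Fin 3) F) : Matrix (Fin 3) (Fin 3) F) 0 0) ≠ 0 := (map_ne_zero _).2 hd0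
      have key : (normAbs F (((blockDiagonalGL F (id : Fin 3 → Fin 3) m : GL (Fin 3) F) : Matrix (Fin 3) (Fin 3) F) 0 0) * (normAbs F (((blockDiagonalGL F (id : Fin 3 → Fin 3) m : GL (Fin 3) F) : Matrix (Fin 3) (Fin 3) F) 1 1))⁻¹ : ℝ≥0) *
          normAbs F (((blockDiagonalGL F (id : Fin 3 → Fin 3) m : GL (Fin 3) F) : Matrix (Fin 3) (Fin 3) F) 2 2 / ((blockDiagonalGL F (id : Fin 3 → Fin 3) m : GL (Fin 3) F) : Matrix (Fin 3) (Fin 3) F) 1 1)⁻¹ =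
          normAbs F (((blockDiagonalGL F (id : Fin 3 → Fin 3) m : GL (Fin 3) F) : Matrix (Fin 3) (Fin 3) F) 0 0) * (normAbs F (((blockDiagonalGL F (id : Fin 3 → Fin 3) m : GL (Fin 3) F) : Matrix (Fin 3) (Fin 3) F) 2 2))⁻¹ := by
        rw [inv_div, map_div₀]
        field_simp
      rw [hew, hδ1, hδ2, ← key]
      push_cast
      ring
      )
  refine ⟨Λ, hker, hne, fun m x hx => ?_⟩
  rw [hequiv m x hx]
  congr 2
  have hew' : ew * ((rootDeltaChar (standardParabolicGL F (id : Fin 3 → Fin 3))).comp (leviEmbeddingP F (id : Fin 3 → Fin 3)))⁻¹ =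
      χ.comp ((leviProjection F (id : Fin 3 → Fin 3)).comp conjB) := by
    ext n
    simp only [ew, MonoidHom.mul_apply, MonoidHom.inv_apply, MonoidHom.coe_comp, Function.comp_apply, mul_inv_cancel_right]
  rw [hew']
  rfl

/-! ## §2 Cell `s₁s₂ = (0→1→2→0)`: `Γ = U_{Q′} ≅ F × F` (normal in `U`), `S = U_{α₂}` -/

set_option maxHeartbeats 400000 in
/-- **The `(Q,B)`-cell `s₁s₂ = (0→1→2→0)` contributes exactly a line to `r_U(Ind_Q σ′)`, with exponent `χ ∘ Ad(P_{s₁s₂})`** — for every smooth character `σ′` of `Q` on `ℂ` whose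
restriction to `B` is `δ_B^{1∕2}·(χ ∘ proj_B)` (`hσB`).  ★ GEO-QB (G2) with the `(Q,B)`-cell datum `(U_{α₂}, U_{Q′})` of ★ (G3a) §3; `Γ = U_{Q′}` is normal in `U`, the Haar measure
`μ_F ⊗ μ_F` transported to `Γ` is invariant under the shears `γ ↦ s⁻¹γs` (`s ∈ S`), which gives `hinv`; `hT` by a diagonal scaling whose module is `δ_B^{1/2}(diag)/δ_B^{1/2}(P diag P⁻¹)`
(★ `rootDeltaChar_borel_three`; ★ E3β₃b verbatim with `P_{id} ↦ Q`). [cite: BernsteinZelevinsky1977, Thm. 5.2] [cite: Casselman1995, §6.3, Thm. 6.3.5] -/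
theorem exists_lineFunctional_cellQ_cycle_one_two_zero (hσ' : σ'.IsSmooth)
    (hσB : ∀ (g : GL (Fin 3) F) (hg : g ∈ standardParabolicGL F (id : Fin 3 → Fin 3)) (z : ℂ),
      σ' ⟨g, borel_le_standardParabolicGL monotone_twoOne hg⟩ z =
        ((rootDeltaChar (standardParabolicGL F (id : Fin 3 → Fin 3)) ⟨g, hg⟩ : ℂˣ) : ℂ) * ((((χ (leviProjection F (id : Fin 3 → Fin 3) ⟨g, hg⟩)) : ℂˣ) : ℂ) * z)) :
    let I := smoothIndRep (standardParabolicGL F (![false, false, true] : Fin 3 → Bool)) σ'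
    let mk := Coinvariants.mk (restrictUnipotentGL F (id : Fin 3 → Fin 3) I)
    let Flt := (vanishingOn (standardParabolicGL F (![false, false, true] : Fin 3 → Bool)) σ' (cellLT (K := F) (![false, false, true] : Fin 3 → Bool) (Equiv.swap (0 : Fin 3) 1 * Equiv.swap (1 : Fin 3) 2))).map mk
    let Fle := (vanishingOn (standardParabolicGL F (![false, false, true] : Fin 3 → Bool)) σ' (cellLE (K := F) (![false, false, true] : Fin 3 → Bool) (Equiv.swap (0 : Fin 3) 1 * Equiv.swap (1 : Fin 3) 2))).map mk
    ∃ Λ : (restrictUnipotentGL F (id : Fin 3 → Fin 3) I).Coinvariants →ₗ[ℂ] ℂ,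
      (∀ x ∈ Flt, Λ x = 0 ↔ x ∈ Fle) ∧ (∃ x ∈ Flt, Λ x ≠ 0) ∧
      ∀ (m : (Π a : Fin 3, GL {i : Fin 3 // (id : Fin 3 → Fin 3) i = a} F)), ∀ x ∈ Flt,
        Λ (Representation.normalizedJacquetGL F (id : Fin 3 → Fin 3) I m x) =
          ((χ (leviProjection F (id : Fin 3 → Fin 3) ⟨(permGL (Equiv.swap (0 : Fin 3) 1 * Equiv.swap (1 : Fin 3) 2) : GL (Fin 3) F) * blockDiagonalGL F (id : Fin 3 → Fin 3) m * (permGL (Equiv.swap (0 : Fin 3) 1 * Equiv.swap (1 : Fin 3) 2) : GL (Fin 3) F)⁻¹, permGL_conj_blockDiagonalGL_mem_borel (Equiv.swap (0 : Fin 3) 1 * Equiv.swap (1 : Fin 3) 2) m⟩) : ℂˣ) : ℂ) * Λ x := by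
  intro I mk Flt Fle
  -- `σ′` is trivial on `U` (`U ≤ B`, ★ E3β₃a)
  have hσU : ∀ (u : GL (Fin 3) F) (hu : u ∈ upperUnitriangular (Fin 3) F) (z : ℂ),
      σ' ⟨u, borel_le_standardParabolicGL monotone_twoOne (unipotentRadicalGL_le F (id : Fin 3 → Fin 3) hu)⟩ z = z := fun u hu z => by
    rw [hσB _ (unipotentRadicalGL_le F (id : Fin 3 → Fin 3) hu), ← inducingChar_apply]
    exact inducingChar_apply_of_mem_upperUnitriangular χ hu z
  haveI : T2Space F := (isLocalField F).toT2Space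
  haveI : LocallyCompactSpace F := (isLocalField F).toLocallyCompactSpace
  haveI : SecondCountableTopology F := secondCountableTopology_localField F
  letI : MeasurableSpace F := borel F
  haveI : BorelSpace F := ⟨rfl⟩
  -- the cell datum (★ E3β₁) and the retraction (★ E3β₂)
  obtain ⟨-, -, hSBB, -⟩ := cellDatum_cycle_one_two_zero (F := F)
  obtain ⟨hΓlow, hS, hSB, hdec⟩ := cellDatumQ_cycle_one_two_zero (F := F)
  have hΓU : unipotentRadicalGL F (![false, true, true] : Fin 3 → Bool) ≤ upperUnitriangular (Fin 3) F := (rootSubgroups_le (F := F)).2.1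
  have hSU : unipotentRadicalGL F (![false, false, true] : Fin 3 → Bool) ⊓ standardLeviGL F (![false, true, true] : Fin 3 → Bool) ≤ upperUnitriangular (Fin 3) F := (rootSubgroups_le (F := F)).2.2.2
  have hΓcl : IsClosed ((unipotentRadicalGL F (![false, true, true] : Fin 3 → Bool) : Subgroup (GL (Fin 3) F)) : Set (GL (Fin 3) F)) := isClosed_unipotentRadicalGL _
  have hΓlim : IsLimitOfCompactOpen ↥(unipotentRadicalGL F (![false, true, true] : Fin 3 → Bool)) := (isLimitOfCompactOpen_upperUnitriangular F 3).of_le hΓU hΓcl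
  obtain ⟨proj, hproj, hprojS⟩ := exists_proj_cycle_one_two_zero (F := F)
  -- coordinates (★ p11) and the transported Haar measure `μ_F ⊗ μ_F` on `Γ` (★ E3β₂)
  obtain ⟨e, he⟩ := exists_coordHomeomorph (R := F)
  obtain ⟨φ, hφ, hφadd⟩ := exists_homeomorph_unipotentRadicalGL_oneTwo e he
  letI : MeasurableSpace ↥(unipotentRadicalGL F (![false, true, true] : Fin 3 → Bool)) := borel _
  haveI : BorelSpace ↥(unipotentRadicalGL F (![false, true, true] : Fin 3 → Bool)) := ⟨rfl⟩
  obtain ⟨i1, i2, i3⟩ := measure_map_addHomeomorph φ hφadd (((Measure.addHaar : Measure F)).prod (Measure.addHaar : Measure F))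
  haveI := i1; haveI := i2; haveI := i3
  have hme : MeasurableEmbedding φ := φ.measurableEmbedding
  -- the torus character `e_w = (χ ∘ levi ∘ Ad P_w ∘ diag) · (δ^{1/2} ∘ diag)`
  let conjB : (Π a : Fin 3, GL {i : Fin 3 // (id : Fin 3 → Fin 3) i = a} F) →* ↥(standardParabolicGL F (id : Fin 3 → Fin 3)) :=
    ((MulAut.conj (permGL (Equiv.swap (0 : Fin 3) 1 * Equiv.swap (1 : Fin 3) 2) : GL (Fin 3) F)).toMonoidHom.comp (blockDiagonalGL F (id : Fin 3 → Fin 3))).codRestrict (standardParabolicGL F (id : Fin 3 → Fin 3))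
      (fun m => permGL_conj_blockDiagonalGL_mem_borel (Equiv.swap (0 : Fin 3) 1 * Equiv.swap (1 : Fin 3) 2) m)
  let ew : (Π a : Fin 3, GL {i : Fin 3 // (id : Fin 3 → Fin 3) i = a} F) →* ℂˣ := (χ.comp ((leviProjection F (id : Fin 3 → Fin 3)).comp conjB)) *
    (rootDeltaChar (standardParabolicGL F (id : Fin 3 → Fin 3))).comp (leviEmbeddingP F (id : Fin 3 → Fin 3))
  obtain ⟨Λ, hker, hne, hequiv⟩ := K2E3ParabolicCellJacquetLine.exists_lineFunctional_of_cellDatum (![false, false, true] : Fin 3 → Bool) monotone_twoOne σ' (Equiv.swap (0 : Fin 3) 1 * Equiv.swap (1 : Fin 3) 2) (unipotentRadicalGL F (![false, true, true] : Fin 3 → Bool)) (unipotentRadicalGL F (![false, false, true] : Fin 3 → Bool) ⊓ standardLeviGL F (![false, true, true] : Fin 3 → Bool)) hσ'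
    hΓU hΓcl hΓlim hΓlow hS hSB hdec proj hproj hprojS ((((Measure.addHaar : Measure F)).prod (Measure.addHaar : Measure F)).map φ)
    (by
      intro u hu f hf
      obtain ⟨s₀, hs₀, γ₀, hγ₀, rfl⟩ := hdec u hu
      -- `s₀` in coordinates
      obtain ⟨-, hz1, hz2⟩ := (mem_rootGroup_oneTwo_iff s₀).1 hs₀
      set a : F := (s₀ : Matrix (Fin 3) (Fin 3) F) 1 2 with ha
      have hs₀c : s₀ = ((e ((0, a), 0) : ↥(unipotentRadicalGL F (id : Fin 3 → Fin 3))) : GL (Fin 3) F) := by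
        conv_lhs => rw [eq_coord e he s₀ (hSU hs₀)]
        rw [hz1, hz2]
      have hB' := hSBB _ hs₀
      have hU' : (permGL (Equiv.swap (0 : Fin 3) 1 * Equiv.swap (1 : Fin 3) 2) : GL (Fin 3) F) * s₀ * (permGL (Equiv.swap (0 : Fin 3) 1 * Equiv.swap (1 : Fin 3) 2) : GL (Fin 3) F)⁻¹ ∈ upperUnitriangular (Fin 3) F := permGL_conj_mem_upperUnitriangular _ (hSU hs₀) hB'
      have hfun : (fun γ : ↥(unipotentRadicalGL F (![false, true, true] : Fin 3 → Bool)) => (smoothIndRep (standardParabolicGL F (![false, false, true] : Fin 3 → Bool)) σ' (s₀ * γ₀) f).toFun ((permGL (Equiv.swap (0 : Fin 3) 1 * Equiv.swap (1 : Fin 3) 2) : GL (Fin 3) F) * ((γ : ↥(unipotentRadicalGL F (![false, true, true] : Fin 3 → Bool))) : GL (Fin 3) F))) =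
          fun γ => f.toFun ((permGL (Equiv.swap (0 : Fin 3) 1 * Equiv.swap (1 : Fin 3) 2) : GL (Fin 3) F) * ((s₀⁻¹ * ((γ : ↥(unipotentRadicalGL F (![false, true, true] : Fin 3 → Bool))) : GL (Fin 3) F) * s₀) * γ₀)) := by
        funext γ
        rw [toFun_smoothIndRep_apply]
        have hprod : (permGL (Equiv.swap (0 : Fin 3) 1 * Equiv.swap (1 : Fin 3) 2) : GL (Fin 3) F) * ((γ : ↥(unipotentRadicalGL F (![false, true, true] : Fin 3 → Bool))) : GL (Fin 3) F) * (s₀ * γ₀) = ((permGL (Equiv.swap (0 : Fin 3) 1 * Equiv.swap (1 : Fin 3) 2) : GL (Fin 3) F) * s₀ * (permGL (Equiv.swap (0 : Fin 3) 1 * Equiv.swap (1 : Fin 3) 2) : GL (Fin 3) F)⁻¹) * ((permGL (Equiv.swap (0 : Fin 3) 1 * Equiv.swap (1 : Fin 3) 2) : GL (Fin 3) F) * ((s₀⁻¹ * ((γ : ↥(unipotentRadicalGL F (![false, true, true] : Fin 3 → Bool))) : GL (Fin 3) F) * s₀) * γ₀)) := by group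
        rw [hprod]
        refine (SmoothInd.toFun_subgroup_mul f ⟨_, borel_le_standardParabolicGL monotone_twoOne (unipotentRadicalGL_le F (id : Fin 3 → Fin 3) hU')⟩ _).trans ?_
        exact hσU _ hU' _
      rw [hfun, hme.integral_map, hme.integral_map]
      -- the shear `q ↦ φ⁻¹(s₀⁻¹ φ(q) s₀)` preserves `μ_F ⊗ μ_F`
      have hconj : ∀ q : F × F, s₀⁻¹ * ((φ q : ↥(unipotentRadicalGL F (![false, true, true] : Fin 3 → Bool))) : GL (Fin 3) F) * s₀ = ((φ ((q.1, q.2 + q.1 * a)) : ↥(unipotentRadicalGL F (![false, true, true] : Fin 3 → Bool))) : GL (Fin 3) F) := by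
        intro q
        rw [hφ, hφ, hs₀c, rootGroup_oneTwo_inv_mul_coord_mul e he]
      simp_rw [hconj]
      let sh : F × F ≃ₜ F × F :=
        { toFun := fun q => (q.1, q.2 + q.1 * a), invFun := fun q => (q.1, q.2 - q.1 * a),
          left_inv := fun q => by ext <;> simp, right_inv := fun q => by ext <;> simp,
          continuous_toFun := by fun_prop, continuous_invFun := by fun_prop }
      have hshear : MeasurePreserving sh (((Measure.addHaar : Measure F)).prod (Measure.addHaar : Measure F)) (((Measure.addHaar : Measure F)).prod (Measure.addHaar : Measure F)) := by
        refine (MeasurePreserving.id (Measure.addHaar : Measure F)).skew_product (g := fun x z => ((x, z + x * a)).2) (by fun_prop)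
          (Eventually.of_forall fun x => ?_)
        simpa [sub_eq_add_neg] using map_add_right_eq_self (Measure.addHaar : Measure F) (x * a)
      have hR : ∫ q, f.toFun ((permGL (Equiv.swap (0 : Fin 3) 1 * Equiv.swap (1 : Fin 3) 2) : GL (Fin 3) F) * (((φ q * ⟨γ₀, hγ₀⟩ : ↥(unipotentRadicalGL F (![false, true, true] : Fin 3 → Bool)))) : GL (Fin 3) F)) ∂(((Measure.addHaar : Measure F)).prod (Measure.addHaar : Measure F)) =
          ∫ q, f.toFun ((permGL (Equiv.swap (0 : Fin 3) 1 * Equiv.swap (1 : Fin 3) 2) : GL (Fin 3) F) * ((φ q : ↥(unipotentRadicalGL F (![false, true, true] : Fin 3 → Bool))) : GL (Fin 3) F)) ∂(((Measure.addHaar : Measure F)).prod (Measure.addHaar : Measure F)) := by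
        have h := integral_mul_right_eq_self (μ := (((Measure.addHaar : Measure F)).prod (Measure.addHaar : Measure F)).map φ) (fun γ : ↥(unipotentRadicalGL F (![false, true, true] : Fin 3 → Bool)) => f.toFun ((permGL (Equiv.swap (0 : Fin 3) 1 * Equiv.swap (1 : Fin 3) 2) : GL (Fin 3) F) * ((γ : ↥(unipotentRadicalGL F (![false, true, true] : Fin 3 → Bool))) : GL (Fin 3) F))) ⟨γ₀, hγ₀⟩
        rwa [hme.integral_map, hme.integral_map] at h
      refine (hshear.integral_comp sh.measurableEmbedding (fun q : F × F => f.toFun ((permGL (Equiv.swap (0 : Fin 3) 1 * Equiv.swap (1 : Fin 3) 2) : GL (Fin 3) F) * (((φ q * ⟨γ₀, hγ₀⟩ : ↥(unipotentRadicalGL F (![false, true, true] : Fin 3 → Bool)))) : GL (Fin 3) F)))).trans ?_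
      exact hR) ew
    (by
      intro m f hf
      have hd0 := blockDiagonalGL_id_three_apply_ne_zero m 0
      have hd1 := blockDiagonalGL_id_three_apply_ne_zero m 1
      have hd2 := blockDiagonalGL_id_three_apply_ne_zero m 2
      have hmemB : (permGL (Equiv.swap (0 : Fin 3) 1 * Equiv.swap (1 : Fin 3) 2) : GL (Fin 3) F) * blockDiagonalGL F (id : Fin 3 → Fin 3) m * (permGL (Equiv.swap (0 : Fin 3) 1 * Equiv.swap (1 : Fin 3) 2) : GL (Fin 3) F)⁻¹ ∈ standardParabolicGL F (id : Fin 3 → Fin 3) := permGL_conj_blockDiagonalGL_mem_borel (Equiv.swap (0 : Fin 3) 1 * Equiv.swap (1 : Fin 3) 2) m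
      have hfun : (fun γ : ↥(unipotentRadicalGL F (![false, true, true] : Fin 3 → Bool)) => (smoothIndRep (standardParabolicGL F (![false, false, true] : Fin 3 → Bool)) σ' (blockDiagonalGL F (id : Fin 3 → Fin 3) m) f).toFun ((permGL (Equiv.swap (0 : Fin 3) 1 * Equiv.swap (1 : Fin 3) 2) : GL (Fin 3) F) * ((γ : ↥(unipotentRadicalGL F (![false, true, true] : Fin 3 → Bool))) : GL (Fin 3) F))) =
          fun γ => (((rootDeltaChar (standardParabolicGL F (id : Fin 3 → Fin 3)) ⟨_, hmemB⟩ : ℂˣ) : ℂ) * (((χ (leviProjection F (id : Fin 3 → Fin 3) ⟨_, hmemB⟩)) : ℂˣ) : ℂ)) *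
            f.toFun ((permGL (Equiv.swap (0 : Fin 3) 1 * Equiv.swap (1 : Fin 3) 2) : GL (Fin 3) F) * ((blockDiagonalGL F (id : Fin 3 → Fin 3) m)⁻¹ * ((γ : ↥(unipotentRadicalGL F (![false, true, true] : Fin 3 → Bool))) : GL (Fin 3) F) * blockDiagonalGL F (id : Fin 3 → Fin 3) m)) := by
        funext γ
        rw [toFun_smoothIndRep_apply]
        have hprod : (permGL (Equiv.swap (0 : Fin 3) 1 * Equiv.swap (1 : Fin 3) 2) : GL (Fin 3) F) * ((γ : ↥(unipotentRadicalGL F (![false, true, true] : Fin 3 → Bool))) : GL (Fin 3) F) * blockDiagonalGL F (id : Fin 3 → Fin 3) m = ((permGL (Equiv.swap (0 : Fin 3) 1 * Equiv.swap (1 : Fin 3) 2) : GL (Fin 3) F) * blockDiagonalGL F (id : Fin 3 → Fin 3) m * (permGL (Equiv.swap (0 : Fin 3) 1 * Equiv.swap (1 : Fin 3) 2) : GL (Fin 3) F)⁻¹) * ((permGL (Equiv.swap (0 : Fin 3) 1 * Equiv.swap (1 : Fin 3) 2) : GL (Fin 3) F) * ((blockDiagonalGL F (id : Fin 3 → Fin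 3) m)⁻¹ * ((γ : ↥(unipotentRadicalGL F (![false, true, true] : Fin 3 → Bool))) : GL (Fin 3) F) * blockDiagonalGL F (id : Fin 3 → Fin 3) m)) := by group
        rw [hprod]
        refine (SmoothInd.toFun_subgroup_mul f ⟨_, borel_le_standardParabolicGL monotone_twoOne hmemB⟩ _).trans ?_
        rw [hσB _ hmemB]
        exact (mul_assoc _ _ _).symm
      rw [hfun, integral_const_mul]
      have hα : (((blockDiagonalGL F (id : Fin 3 → Fin 3) m : GL (Fin 3) F) : Matrix (Fin 3) (Fin 3) F) 1 1 / ((blockDiagonalGL F (id : Fin 3 → Fin 3) m : GL (Fin 3) F) : Matrix (Fin 3) (Fin 3) F) 0 0) ≠ 0 := div_ne_zero hd1 hd0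
      have hβ : (((blockDiagonalGL F (id : Fin 3 → Fin 3) m : GL (Fin 3) F) : Matrix (Fin 3) (Fin 3) F) 2 2 / ((blockDiagonalGL F (id : Fin 3 → Fin 3) m : GL (Fin 3) F) : Matrix (Fin 3) (Fin 3) F) 0 0) ≠ 0 := div_ne_zero hd2 hd0
      have hconj : ∀ q : F × F, (blockDiagonalGL F (id : Fin 3 → Fin 3) m)⁻¹ * ((φ q : ↥(unipotentRadicalGL F (![false, true, true] : Fin 3 → Bool))) : GL (Fin 3) F) * blockDiagonalGL F (id : Fin 3 → Fin 3) m = ((φ ((((blockDiagonalGL F (id : Fin 3 → Fin 3) m : GL (Fin 3) F) : Matrix (Fin 3) (Fin 3) F) 1 1 / ((blockDiagonalGL F (id : Fin 3 → Fin 3) m : GL (Fin 3) F) : Matrix (Fin 3) (Fin 3) F) 0 0) * q.1, (((blockDiagonalGL F (id : Fin 3 → Fin 3) m : GL (Fin 3) F) : Matrix (Fin 3) (Fin 3) F) 2 2 / ((blockDiagonalGL F (id : Fin 3 → Fin 3) m : GL (Fin 3) F) : Matrix (Fin 3) (Fin 3) F) 0 0) * q.2) : ↥(unipotentRadicalGL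 F (![false, true, true] : Fin 3 → Bool))) : GL (Fin 3) F) := by
        intro q
        rw [hφ, hφ, blockDiagonalGL_inv_mul_coord_mul e he m ((q.1, 0), q.2)]
        congr 2
        ext <;> simp <;> ring
      have hsub : ∫ γ, f.toFun ((permGL (Equiv.swap (0 : Fin 3) 1 * Equiv.swap (1 : Fin 3) 2) : GL (Fin 3) F) * ((blockDiagonalGL F (id : Fin 3 → Fin 3) m)⁻¹ * ((γ : ↥(unipotentRadicalGL F (![false, true, true] : Fin 3 → Bool))) : GL (Fin 3) F) * blockDiagonalGL F (id : Fin 3 → Fin 3) m)) ∂((((Measure.addHaar : Measure F)).prod (Measure.addHaar : Measure F)).map φ) =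
          ((normAbs F (((blockDiagonalGL F (id : Fin 3 → Fin 3) m : GL (Fin 3) F) : Matrix (Fin 3) (Fin 3) F) 1 1 / ((blockDiagonalGL F (id : Fin 3 → Fin 3) m : GL (Fin 3) F) : Matrix (Fin 3) (Fin 3) F) 0 0)⁻¹ * normAbs F (((blockDiagonalGL F (id : Fin 3 → Fin 3) m : GL (Fin 3) F) : Matrix (Fin 3) (Fin 3) F) 2 2 / ((blockDiagonalGL F (id : Fin 3 → Fin 3) m : GL (Fin 3) F) : Matrix (Fin 3) (Fin 3) F) 0 0)⁻¹ : ℝ≥0) : ℝ) *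
            ∫ γ, f.toFun ((permGL (Equiv.swap (0 : Fin 3) 1 * Equiv.swap (1 : Fin 3) 2) : GL (Fin 3) F) * ((γ : ↥(unipotentRadicalGL F (![false, true, true] : Fin 3 → Bool))) : GL (Fin 3) F)) ∂((((Measure.addHaar : Measure F)).prod (Measure.addHaar : Measure F)).map φ) := by
        rw [hme.integral_map, hme.integral_map]
        simp_rw [hconj]
        have hmap := map_prodScale (Measure.addHaar : Measure F) hα hβ
        have heq := integral_map_equiv (((Homeomorph.mulLeft₀ _ hα).prodCongr (Homeomorph.mulLeft₀ _ hβ)).toMeasurableEquiv)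
          (fun q : F × F => f.toFun ((permGL (Equiv.swap (0 : Fin 3) 1 * Equiv.swap (1 : Fin 3) 2) : GL (Fin 3) F) * ((φ q : ↥(unipotentRadicalGL F (![false, true, true] : Fin 3 → Bool))) : GL (Fin 3) F))) (μ := ((Measure.addHaar : Measure F)).prod (Measure.addHaar : Measure F))
        rw [Homeomorph.toMeasurableEquiv_coe] at heq
        change ∫ y, f.toFun ((permGL (Equiv.swap (0 : Fin 3) 1 * Equiv.swap (1 : Fin 3) 2) : GL (Fin 3) F) * ((φ y : ↥(unipotentRadicalGL F (![false, true, true] : Fin 3 → Bool))) : GL (Fin 3) F)) ∂((((Measure.addHaar : Measure F)).prod (Measure.addHaar : Measure F)).map (fun q : F × F => ((((blockDiagonalGL F (id : Fin 3 → Fin 3) m : GL (Fin 3) F) : Matrix (Fin 3) (Fin 3) F) 1 1 / ((blockDiagonalGL F (id : Fin 3 → Fin 3) m : GL (Fin 3) F) : Matrix (Fin 3) (Fin 3) F) 0 0) * q.1, (((blockDiagonalGL F (id : Fin 3 → Fin 3) m : GL (Fin 3) F) : Matrix (Fin 3) (Fin 3) F) 2 2 / ((blockDiagonalGL F (id : Fin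 3 → Fin 3) m : GL (Fin 3) F) : Matrix (Fin 3) (Fin 3) F) 0 0) * q.2))) =
          ∫ q, f.toFun ((permGL (Equiv.swap (0 : Fin 3) 1 * Equiv.swap (1 : Fin 3) 2) : GL (Fin 3) F) * ((φ ((((blockDiagonalGL F (id : Fin 3 → Fin 3) m : GL (Fin 3) F) : Matrix (Fin 3) (Fin 3) F) 1 1 / ((blockDiagonalGL F (id : Fin 3 → Fin 3) m : GL (Fin 3) F) : Matrix (Fin 3) (Fin 3) F) 0 0) * q.1, (((blockDiagonalGL F (id : Fin 3 → Fin 3) m : GL (Fin 3) F) : Matrix (Fin 3) (Fin 3) F) 2 2 / ((blockDiagonalGL F (id : Fin 3 → Fin 3) m : GL (Fin 3) F) : Matrix (Fin 3) (Fin 3) F) 0 0) * q.2) : ↥(unipotentRadicalGL F (![false, true, true] : Fin 3 → Bool))) : GL (Fin 3) F)) ∂(((Measure.addHaar : Measure F)).prod (Measure.addHaar : Measure F)) at heq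
        rw [← heq, hmap, integral_smul_measure, ENNReal.coe_toReal, Complex.real_smul]
      rw [hsub]
      have hw0 : (Equiv.swap (0 : Fin 3) 1 * Equiv.swap (1 : Fin 3) 2) 0 = 1 := by decide
      have hw2 : (Equiv.swap (0 : Fin 3) 1 * Equiv.swap (1 : Fin 3) 2) 2 = 0 := by decide
      have hew : ((ew m : ℂˣ) : ℂ) = (((χ (leviProjection F (id : Fin 3 → Fin 3) ⟨_, hmemB⟩)) : ℂˣ) : ℂ) *
          ((rootDeltaChar (standardParabolicGL F (id : Fin 3 → Fin 3)) (leviEmbeddingP F (id : Fin 3 → Fin 3) m) : ℂˣ) : ℂ) := by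
        simp only [ew, MonoidHom.mul_apply, MonoidHom.coe_comp, Function.comp_apply, Units.val_mul]
        rfl
      have hδ1 : ((rootDeltaChar (standardParabolicGL F (id : Fin 3 → Fin 3)) ⟨_, hmemB⟩ : ℂˣ) : ℂ) =
          (((normAbs F (((blockDiagonalGL F (id : Fin 3 → Fin 3) m : GL (Fin 3) F) : Matrix (Fin 3) (Fin 3) F) 1 1) * (normAbs F (((blockDiagonalGL F (id : Fin 3 → Fin 3) m : GL (Fin 3) F) : Matrix (Fin 3) (Fin 3) F) 0 0))⁻¹ : ℝ≥0) : ℝ) : ℂ) := by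
        rw [K2E3GL3BorelModulus.rootDeltaChar_borel_three]
        simp only [permGL_conj_apply, hw0, hw2]
      have hδ2 : ((rootDeltaChar (standardParabolicGL F (id : Fin 3 → Fin 3)) (leviEmbeddingP F (id : Fin 3 → Fin 3) m) : ℂˣ) : ℂ) =
          (((normAbs F (((blockDiagonalGL F (id : Fin 3 → Fin 3) m : GL (Fin 3) F) : Matrix (Fin 3) (Fin 3) F) 0 0) * (normAbs F (((blockDiagonalGL F (id : Fin 3 → Fin 3) m : GL (Fin 3) F) : Matrix (Fin 3) (Fin 3) F) 2 2))⁻¹ : ℝ≥0) : ℝ) : ℂ) := by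
        rw [K2E3GL3BorelModulus.rootDeltaChar_borel_three, coe_leviEmbeddingP]
      have hn0 : normAbs F (((blockDiagonalGL F (id : Fin 3 → Fin 3) m : GL (Fin 3) F) : Matrix (Fin 3) (Fin 3) F) 0 0) ≠ 0 := (map_ne_zero _).2 hd0
      have hn1 : normAbs F (((blockDiagonalGL F (id : Fin 3 → Fin 3) m : GL (Fin 3) F) : Matrix (Fin 3) (Fin 3) F) 1 1) ≠ 0 := (map_ne_zero _).2 hd1
      have hn2 : normAbs F (((blockDiagonalGL F (id : Fin 3 → Fin 3) m : GL (Fin 3) F) : Matrix (Fin 3) (Fin 3) F) 2 2) ≠ 0 := (map_ne_zero _).2 hd2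
      have key : (normAbs F (((blockDiagonalGL F (id : Fin 3 → Fin 3) m : GL (Fin 3) F) : Matrix (Fin 3) (Fin 3) F) 1 1) * (normAbs F (((blockDiagonalGL F (id : Fin 3 → Fin 3) m : GL (Fin 3) F) : Matrix (Fin 3) (Fin 3) F) 0 0))⁻¹ : ℝ≥0) *
          (normAbs F (((blockDiagonalGL F (id : Fin 3 → Fin 3) m : GL (Fin 3) F) : Matrix (Fin 3) (Fin 3) F) 1 1 / ((blockDiagonalGL F (id : Fin 3 → Fin 3) m : GL (Fin 3) F) : Matrix (Fin 3) (Fin 3) F) 0 0)⁻¹ * normAbs F (((blockDiagonalGL F (id : Fin 3 → Fin 3) m : GL (Fin 3) F) : Matrix (Fin 3) (Fin 3) F) 2 2 / ((blockDiagonalGL F (id : Fin 3 → Fin 3) m : GL (Fin 3) F) : Matrix (Fin 3) (Fin 3) F) 0 0)⁻¹) = normAbs F (((blockDiagonalGL F (id : Fin 3 → Fin 3) m : GL (Fin 3) F) : Matrix (Fin 3) (Fin 3) F) 0 0) * (normAbs F (((blockDiagonalGL F (id : Fin 3 → Fin 3) m : GL (Fin 3) F) : Matrix (Fin 3) (Fin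 3) F) 2 2))⁻¹ := by
        rw [inv_div, inv_div, map_div₀, map_div₀]
        field_simp
      rw [hew, hδ1, hδ2, ← key]
      push_cast
      ring)
  refine ⟨Λ, hker, hne, fun m x hx => ?_⟩
  rw [hequiv m x hx]
  congr 2
  have hew' : ew * ((rootDeltaChar (standardParabolicGL F (id : Fin 3 → Fin 3))).comp (leviEmbeddingP F (id : Fin 3 → Fin 3)))⁻¹ =
      χ.comp ((leviProjection F (id : Fin 3 → Fin 3)).comp conjB) := by
    ext n
    simp only [ew, MonoidHom.mul_apply, MonoidHom.inv_apply, MonoidHom.coe_comp, Function.comp_apply, mul_inv_cancel_right]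
  rw [hew']
  rfl

end Summit.HodgeConjecture.HodgeConjecture.Cruxes.H413.K2E3GL3StandardModuleJacquetLines

end
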